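import Literature.Probability.Process.GaussianBridgeLemmas
import HarnessLib

/-!
# The Brownian loop measure at `0` in `ℝ⁴` and its `h`-transform density on `𝓕_t`

Topic `Probability/Process`; definitions with bodies and theorems, no named fact. Following
Lawler–Schramm–Werner, *Conformal restriction: the chordal case*, JAMS **16** (2003) (**[LSW]**),
§7.1, second bullet — the Brownian bubble measure at `0` is, up to a constant, the image of
`T^{-1/2} n(de) ⊗ P(db)` under `(b, e) ↦ fill(T^{1/2} b(·/T) + i e)`, `n` Itô's excursion measure
(lifetime density `∝ T^{-3/2}`), `b` a Brownian bridge — we lift the construction to `ℝ⁴` as the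
tree lifts the Brownian excursion of [LSW] §4 (`RandomPlanarGeometry/BrownianExcursionRestriction`:
a three-dimensional Bessel bridge is the modulus of a three-dimensional Brownian bridge, so the
bridge-plus-excursion of the bullet is the image `W⁰ + i|w|` of a FOUR-dimensional Brownian bridge
from `0` to `0`):

* `quadLoop T ω s = W_s(ω) − (s/T) W_T(ω)` — the Brownian loop (bridge from `0` to `0`) of
  duration `T` built from `W = brownianQuad` ([Lawler] §5.2: the bridge "has the distribution of
  `B_s − (s/t)B_t`");
* `loopTimeMeasure = 𝟙_{T>0} dT/(2T²)` — the lifetime law (`T^{-1/2} · n(T ∈ dT) ∝ T⁻² dT`), and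
  `loopBase = loopTimeMeasure ⊗ wienerQuad` — **the (lifted) Brownian loop measure at `0`**, an
  infinite σ-finite measure on (duration, sample);
* `newtonFour v = |v|⁻²` — the Newtonian potential of `ℝ⁴` with pole `0`;
* `lintegral_loopBase_eq` — **THE `h`-TRANSFORM DENSITY ON `𝓕_t`**: for `t > 0` and every
  measurable `F ≥ 0` on paths over `[0, t]`,
  `∫ 𝟙{T > t} F(L^T|[0,t]) dloopBase = E[F(W|[0,t]) |W_t|⁻²]`.
  Observed up to time `t`, on loops living longer than `t`, the loop measure is Wiener measure
  weighted by `h(W_t) = |W_t|⁻²`: the loop measure is the excursion measure from the (polar) point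
  `0` of Brownian motion in `ℝ⁴` conditioned to return to `0` (Doob's `h`-transform by the Green
  function `G(·, 0) ∝ |·|⁻²`), in its bridge-mixture form (Fitzsimmons–Pitman–Yor).

Proof of the density (`lintegral_quadLoopPast_eq` + `lintegral_loopBase_eq`): by the weak Markov
property at `t`, `W_T = W_t + ξ` with `ξ ~ N(0, (T−t)I)` independent of `𝓕_t`; by
`indepFun_quadBridgePast`, `W|[0,t] = B⁰ + (·/t)W_t` with the bridge part `B⁰ ⟂ W_t`; hence
`L^T|[0,t] = B⁰ + (·/t)[(1 − t/T)W_t − (t/T)ξ]` with `(1 − t/T)W_t − (t/T)ξ ~ N(0, (t(T−t)/T) I)`, so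
`E F(L^T|[0,t]) = ∫ G dN(0, (t(T−t)/T)I)` with `G(z) = E F(B⁰ + (·/t)z)`, while
`E[F(W|[0,t])|W_t|⁻²] = ∫ G(z)|z|⁻² N(0,tI)(dz)`; finally `N(0, (t(T−t)/T)I) = R_T · N(0, tI)` with
`R_T(z) = (T/(T−t))² e^{−|z|²/(2(T−t))}` and `∫_{T>t} R_T(z) dT/(2T²) = |z|⁻²` (`GaussianBridgeLemmas`).

Not here: the hitting identity `loopBase{L hits F before T} = E[|W_{τ_F}|⁻²; τ_F < ∞]` (optional
stopping, `BrownianLoopHitting4`), the image in `ℍ` and the bubble measure itself.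

## References

* [LSW] G. F. Lawler, O. Schramm, W. Werner, *Conformal restriction: the chordal case*, J. Amer.
  Math. Soc. **16** (2003) 917–955, arXiv:math/0209343, §7.1 (second bullet, p. 28).
  [LawlerSchrammWerner2003Restriction]
* [Lawler] G. F. Lawler, *Conformally Invariant Processes in the Plane*, AMS (2005), §5.2,
  §5.5. [Lawler2005]
* P. Fitzsimmons, J. Pitman, M. Yor, *Markovian bridges: construction, Palm interpretation, and
  splicing*, Seminar on Stochastic Processes 1992, Birkhäuser (1993), §2.
-/

noncomputable section

open MeasureTheory ProbabilityTheory Filter Topology Set Finset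
open scoped NNReal ENNReal BigOperators

namespace Literature.Probability.Process

/-! ### The Brownian loop of duration `T` -/

/-- **The Brownian loop of duration `T` in `ℝ⁴`** built from the four-dimensional Brownian
motion `W = brownianQuad`: `L^T_s = W_s − (s/T) W_T` (`0 ≤ s ≤ T`; a Brownian bridge from `0`
to `0` of duration `T`, [Lawler] §5.2: the bridge "has the distribution of `B_s − (s/t)B_t`").
Junk beyond `s = T` (the same formula). [cite: Lawler2005, §5.2 (Brownian bridge as B_s − (s/t)B_t)] -/
def quadLoop (T : ℝ) (ω : WienerQuad) (s : ℝ≥0) : Fin 4 → ℝ :=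
  brownianQuad s ω - ((s : ℝ) / T) • brownianQuad T.toNNReal ω

/-- The loop observed on `[0, t]`, as a function of the pair (duration, sample). [folklore] -/
def quadLoopPast (t : ℝ≥0) (p : ℝ × WienerQuad) : Set.Iic t → Fin 4 → ℝ :=
  fun s ↦ quadLoop p.1 p.2 s

/-- The linear interpolation `s ↦ (s/t) z` on `[0, t]`. [folklore] -/
def linPast (t : ℝ≥0) (z : Fin 4 → ℝ) : Set.Iic t → Fin 4 → ℝ :=
  fun s ↦ (((s : ℝ≥0) : ℝ) / t) • z

/-- `brownianQuad` is jointly measurable in (time, sample). [folklore] -/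
theorem measurable_uncurry_brownianQuad : Measurable (Function.uncurry brownianQuad) :=
  measurable_uncurry_of_continuous_of_measurable (fun ω ↦ isBrownianVec_brownianQuad.continuous_path ω)
    measurable_brownianQuad

/-- The loop observed on `[0, t]` is jointly measurable in (duration, sample). [folklore] -/
theorem measurable_quadLoopPast (t : ℝ≥0) : Measurable (quadLoopPast t) := by
  refine measurable_pi_lambda _ fun s ↦ ?_
  have h1 : Measurable fun p : ℝ × WienerQuad ↦ brownianQuad s p.2 :=
    (measurable_brownianQuad _).comp measurable_snd
  have h2 : Measurable fun p : ℝ × WienerQuad ↦ brownianQuad p.1.toNNReal p.2 :=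
    measurable_uncurry_brownianQuad.comp ((measurable_real_toNNReal.comp measurable_fst).prodMk measurable_snd)
  have h3 : Measurable fun p : ℝ × WienerQuad ↦ ((s : ℝ≥0) : ℝ) / p.1 := measurable_const.div measurable_fst
  exact h1.sub (h3.smul h2)

/-- `linPast` is measurable. [folklore] -/
theorem measurable_linPast (t : ℝ≥0) : Measurable (linPast t) :=
  measurable_pi_lambda _ fun s ↦ measurable_const_smul ((((s : ℝ≥0) : ℝ) / t))

/-- The averaged functional `G(z) = E[F(bridge + (·/t) z)]`. [folklore] -/
def bridgeAvg (t : ℝ≥0) (F : (Set.Iic t → Fin 4 → ℝ) → ℝ≥0∞) (z : Fin 4 → ℝ) : ℝ≥0∞ :=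
  ∫⁻ ω, F (quadBridgePast t ω + linPast t z) ∂wienerQuad

/-- `G` is measurable. [folklore] -/
theorem measurable_bridgeAvg (t : ℝ≥0) {F : (Set.Iic t → Fin 4 → ℝ) → ℝ≥0∞} (hF : Measurable F) :
    Measurable (bridgeAvg t F) := by
  unfold bridgeAvg
  have h : Measurable fun p : (Fin 4 → ℝ) × WienerQuad ↦ F (quadBridgePast t p.2 + linPast t p.1) :=
    hF.comp (((measurable_quadBridgePast t).comp measurable_snd).add ((measurable_linPast t).comp measurable_fst))
  exact h.lintegral_prod_right'

/-- The bridge variance at time `t` for duration `T`, `(1 − t/T)² t + (t/T)² (T − t) = t(T−t)/T`,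
in the form produced by `map_linComb_gaussVec_prod`. [folklore] -/
def bridgeVar (t : ℝ≥0) (T : ℝ) : ℝ≥0 :=
  NNReal.mk ((1 - (t : ℝ) / T) ^ 2) (sq_nonneg _) * t + NNReal.mk ((-((t : ℝ) / T)) ^ 2) (sq_nonneg _) * (T.toNNReal - t)

/-- `bridgeVar t T = t(T − t)/T` for `0 < t < T`. [folklore] -/
theorem coe_bridgeVar {t : ℝ≥0} {T : ℝ} (ht : 0 < t) (htT : (t : ℝ) < T) :
    (bridgeVar t T : ℝ) = t * (T - t) / T := by
  have hT : 0 < T := lt_trans (by exact_mod_cast ht) htT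
  have hle : t ≤ T.toNNReal := by
    rw [← NNReal.coe_le_coe, Real.coe_toNNReal _ hT.le]; exact htT.le
  unfold bridgeVar
  rw [NNReal.coe_add, NNReal.coe_mul, NNReal.coe_mul, NNReal.coe_mk, NNReal.coe_mk, NNReal.coe_sub hle,
    Real.coe_toNNReal _ hT.le]
  field_simp
  ring

/-- **The law of the loop on `[0, t]` for a fixed duration `T > t`, disintegrated**:
`E[F(L^T|[0,t])] = ∫ G dN(0, (t(T−t)/T) I₄)` with `G(z) = E[F(bridge + (·/t)z)]` — the weak
Markov property at time `t` (`W_T − W_t ⟂ 𝓕_t`, Gaussian), the independence of the bridge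
part from `W_t`, and `(1 − t/T)W_t − (t/T)(W_T − W_t) ~ N(0, t(T−t)/T)`. [folklore] -/
theorem lintegral_quadLoopPast_eq {t : ℝ≥0} (ht : 0 < t) {T : ℝ} (htT : (t : ℝ) < T)
    {F : (Set.Iic t → Fin 4 → ℝ) → ℝ≥0∞} (hF : Measurable F) :
    ∫⁻ ω, F (quadLoopPast t (T, ω)) ∂wienerQuad = ∫⁻ z, bridgeAvg t F z ∂gaussVec 4 (bridgeVar t T) := by
  have hW := isBrownianVec_brownianQuad
  have hT : 0 < T := lt_trans (by exact_mod_cast ht) htT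
  have ht0 : ((t : ℝ≥0) : ℝ) ≠ 0 := by exact_mod_cast ht.ne'
  set T' : ℝ≥0 := T.toNNReal with hT'
  have hTT' : ((T' : ℝ≥0) : ℝ) = T := Real.coe_toNNReal _ hT.le
  have hle : t ≤ T' := by rw [← NNReal.coe_le_coe, hTT']; exact htT.le
  -- the increment after `t`
  set ξ : WienerQuad → Fin 4 → ℝ := fun ω ↦ brownianQuad T' ω - brownianQuad t ω with hξ
  have hξeq : ξ = (fun q : ℝ≥0 → Fin 4 → ℝ ↦ q (T' - t)) ∘ vecShift brownianQuad t := by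
    funext ω
    simp only [hξ, Function.comp_apply, vecShift, add_tsub_cancel_of_le hle]
  have hξm : Measurable ξ := (measurable_brownianQuad _).sub (measurable_brownianQuad _)
  have hind1 : IndepFun (vecPast brownianQuad t) ξ wienerQuad := by
    rw [hξeq]
    exact (hW.indep_shift t).symm.comp measurable_id (measurable_pi_apply _)
  have hlawξ : wienerQuad.map ξ = gaussVec 4 (T' - t) := by
    have := hW.map_incr t (T' - t)
    rw [add_tsub_cancel_of_le hle] at this
    exact this
  -- `L|[0,t] = Ψ(past, ξ)`
  set Ψ : (Set.Iic t → Fin 4 → ℝ) × (Fin 4 → ℝ) → (Set.Iic t → Fin 4 → ℝ) :=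
    fun q s ↦ q.1 s - (((s : ℝ≥0) : ℝ) / T) • (q.1 ⟨t, Set.self_mem_Iic⟩ + q.2) with hΨ
  have hΨm : Measurable Ψ := by
    refine measurable_pi_lambda _ fun s ↦ ?_
    have h1 : Measurable fun q : (Set.Iic t → Fin 4 → ℝ) × (Fin 4 → ℝ) ↦ q.1 s :=
      (measurable_pi_apply s).comp measurable_fst
    have h2 : Measurable fun q : (Set.Iic t → Fin 4 → ℝ) × (Fin 4 → ℝ) ↦
        (((s : ℝ≥0) : ℝ) / T) • (q.1 ⟨t, Set.self_mem_Iic⟩ + q.2) := by fun_prop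
    exact h1.sub h2
  have hloop : ∀ ω, quadLoopPast t (T, ω) = Ψ (vecPast brownianQuad t ω, ξ ω) := by
    intro ω
    funext s
    simp only [quadLoopPast, quadLoop, hΨ, vecPast, hξ, add_sub_cancel, hT']
  -- `Ψ(past, y) = bridge + lin (c W_t + e y)`
  set c : ℝ := 1 - (t : ℝ) / T with hc
  set e : ℝ := -((t : ℝ) / T) with he
  have hdecomp : ∀ ω y, Ψ (vecPast brownianQuad t ω, y) =
      quadBridgePast t ω + linPast t (c • brownianQuad t ω + e • y) := by
    intro ω y
    funext s
    ext i
    simp only [hΨ, vecPast, quadBridgePast, linPast, hc, he, Pi.add_apply, Pi.sub_apply, Pi.smul_apply,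
      smul_eq_mul]
    field_simp
    ring
  have hm2 : Measurable fun p : (Fin 4 → ℝ) × (Fin 4 → ℝ) ↦ c • p.1 + e • p.2 := by fun_prop
  have hl := measurable_linPast t
  -- Step 1: freeze `ξ`
  calc ∫⁻ ω, F (quadLoopPast t (T, ω)) ∂wienerQuad
      = ∫⁻ ω, (F ∘ Ψ) (vecPast brownianQuad t ω, ξ ω) ∂wienerQuad := by
        simp only [Function.comp_apply, hloop]
    _ = ∫⁻ ω, ∫⁻ y, (F ∘ Ψ) (vecPast brownianQuad t ω, y) ∂(wienerQuad.map ξ) ∂wienerQuad :=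
        lintegral_comp_eq_lintegral_lintegral_of_indepFun (hW.measurable_vecPast t) hξm hind1 (hF.comp hΨm)
    _ = ∫⁻ ω, ∫⁻ y, F (quadBridgePast t ω + linPast t (c • brownianQuad t ω + e • y))
          ∂(gaussVec 4 (T' - t)) ∂wienerQuad := by
        simp only [hlawξ, Function.comp_apply, hdecomp]
    -- Step 2: freeze `W_t` (bridge part ⟂ endpoint), then Tonelli
    _ = ∫⁻ ω, ∫⁻ w, ∫⁻ y, F (quadBridgePast t ω + linPast t (c • w + e • y))
          ∂(gaussVec 4 (T' - t)) ∂(gaussVec 4 t) ∂wienerQuad := by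
        have hG2 : Measurable fun q : (Set.Iic t → Fin 4 → ℝ) × (Fin 4 → ℝ) ↦
            ∫⁻ y, F (q.1 + linPast t (c • q.2 + e • y)) ∂(gaussVec 4 (T' - t)) := by
          have hm : Measurable fun r : ((Set.Iic t → Fin 4 → ℝ) × (Fin 4 → ℝ)) × (Fin 4 → ℝ) ↦
              F (r.1.1 + linPast t (c • r.1.2 + e • r.2)) := by fun_prop
          exact hm.lintegral_prod_right'
        have := lintegral_comp_eq_lintegral_lintegral_of_indepFun (measurable_quadBridgePast t)
          (measurable_brownianQuad t) (indepFun_quadBridgePast t) hG2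
        rw [map_brownianQuad] at this
        exact this
    _ = ∫⁻ w, ∫⁻ y, ∫⁻ ω, F (quadBridgePast t ω + linPast t (c • w + e • y))
          ∂wienerQuad ∂(gaussVec 4 (T' - t)) ∂(gaussVec 4 t) := by
        have hb := measurable_quadBridgePast t
        have hm3 : Measurable fun r : (WienerQuad × (Fin 4 → ℝ)) × (Fin 4 → ℝ) ↦
            F (quadBridgePast t r.1.1 + linPast t (c • r.1.2 + e • r.2)) := by fun_prop
        have hm4 : Measurable fun r : WienerQuad × (Fin 4 → ℝ) ↦
            ∫⁻ y, F (quadBridgePast t r.1 + linPast t (c • r.2 + e • y)) ∂(gaussVec 4 (T' - t)) :=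
          hm3.lintegral_prod_right'
        rw [lintegral_lintegral_swap hm4.aemeasurable]
        refine lintegral_congr fun w ↦ ?_
        have hm5 : Measurable fun r : WienerQuad × (Fin 4 → ℝ) ↦
            F (quadBridgePast t r.1 + linPast t (c • w + e • r.2)) := by fun_prop
        rw [lintegral_lintegral_swap hm5.aemeasurable]
    _ = ∫⁻ p, bridgeAvg t F (c • p.1 + e • p.2) ∂((gaussVec 4 t).prod (gaussVec 4 (T' - t))) := by
        exact (lintegral_prod (fun p : (Fin 4 → ℝ) × (Fin 4 → ℝ) ↦ bridgeAvg t F (c • p.1 + e • p.2))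
          (((measurable_bridgeAvg t hF).comp hm2).aemeasurable)).symm
    _ = ∫⁻ z, bridgeAvg t F z ∂gaussVec 4 (bridgeVar t T) := by
        rw [← lintegral_map (measurable_bridgeAvg t hF) hm2, map_linComb_gaussVec_prod]
        rfl


/-! ### The lifetime measure and the loop base measure -/

/-- The lifetime weight `1/(2T²)`. [folklore] -/
def loopDensity (T : ℝ) : ℝ≥0∞ := ENNReal.ofReal (1 / (2 * T ^ 2))

/-- The lifetime weight is measurable. [folklore] -/
@[fun_prop]
theorem measurable_loopDensity : Measurable loopDensity := by
  unfold loopDensity; fun_prop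

/-- **The lifetime measure** `ρ(dT) = 𝟙_{T>0} dT/(2T²)` of the Brownian bubble in `ℝ⁴`
([LSW] §7.1, second bullet: Itô's measure `n(T ∈ dT) ∝ T^{-3/2} dT` times the extra
`T^{-1/2}`). [cite: LawlerSchrammWerner2003Restriction, §7.1 (second bullet, p. 28)] -/
def loopTimeMeasure : Measure ℝ := (volume.restrict (Ioi (0 : ℝ))).withDensity loopDensity

/-- The lifetime measure is s-finite. [folklore] -/
instance sFinite_loopTimeMeasure : SFinite loopTimeMeasure := by
  unfold loopTimeMeasure; infer_instance

/-- **The base measure of the Brownian loops at `0` in `ℝ⁴`**: `ρ ⊗ ℙ` on (duration, sample);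
the loop of duration `T` is `quadLoop T`. [cite: LawlerSchrammWerner2003Restriction, §7.1 (second bullet, p. 28)] -/
def loopBase : Measure (ℝ × WienerQuad) := loopTimeMeasure.prod wienerQuad

/-- The base measure is s-finite. [folklore] -/
instance sFinite_loopBase : SFinite loopBase := by
  unfold loopBase; infer_instance

/-- **The Newtonian potential of `ℝ⁴` at the origin**, `h(v) = 1/|v|²` (as an extended real;
`h(0) = 0` by the junk value of division). [folklore] -/
def newtonFour (v : Fin 4 → ℝ) : ℝ≥0∞ := ENNReal.ofReal (1 / sqSum v)

/-- `newtonFour` is measurable. [folklore] -/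
@[fun_prop]
theorem measurable_newtonFour : Measurable newtonFour := by
  unfold newtonFour
  exact (measurable_const.div measurable_sqSum).ennreal_ofReal

/-- `sqSum z > 0` for `z ≠ 0`. [folklore] -/
theorem sqSum_pos_of_ne_zero {d : ℕ} {z : Fin d → ℝ} (hz : z ≠ 0) : 0 < sqSum z := by
  obtain ⟨i, hi⟩ : ∃ i, z i ≠ 0 := by
    by_contra h
    push Not at h
    exact hz (funext h)
  unfold sqSum
  exact lt_of_lt_of_le (by positivity) (Finset.single_le_sum (fun j _ ↦ sq_nonneg (z j)) (Finset.mem_univ i))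

/-- `N(0, tI)` does not charge the origin (`t ≠ 0`). [folklore] -/
theorem gaussVec_ae_ne_zero (d : ℕ) {t : ℝ≥0} (ht : t ≠ 0) (hd : 0 < d) :
    ∀ᵐ z ∂gaussVec d t, z ≠ 0 := by
  rw [ae_iff]
  simp only [ne_eq, not_not, setOf_eq_eq_singleton]
  have h0 : ({0} : Set (Fin d → ℝ)) = Set.univ.pi fun _ : Fin d ↦ ({0} : Set ℝ) := by
    ext z; simp [funext_iff]
  rw [h0, gaussVec, Measure.pi_pi]
  haveI : NullSingletonClass (gaussianReal 0 t) := nullSingletonClass_gaussianReal ht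
  obtain ⟨i⟩ : Nonempty (Fin d) := ⟨⟨0, hd⟩⟩
  exact Finset.prod_eq_zero (Finset.mem_univ i) (measure_singleton _)

/-- The ratio density in closed form, jointly measurable in (duration, point). [folklore] -/
theorem measurable_ratioDensity (t : ℝ) :
    Measurable fun q : ℝ × (Fin 4 → ℝ) ↦
      ENNReal.ofReal ((q.1 / (q.1 - t)) ^ 2 * Real.exp (-(sqSum q.2 / 2) / (q.1 - t))) := by
  have := measurable_sqSum (d := 4)
  fun_prop

/-- **The `h`-transform density of the Brownian bubble on `𝓕_t`** ([LSW] §7.1 bullet 2 lifted to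
`ℝ⁴`; Fitzsimmons–Pitman–Yor: bridges of an `h`-transform): for `t > 0` and every measurable
functional `F ≥ 0` of the path on `[0, t]`,

  `∫ 𝟙{T > t} F(L^T|[0,t]) d(ρ ⊗ ℙ) = E[F(W|[0,t]) · |W_t|⁻²]`.

Observed up to time `t` (on loops living longer than `t`), the loop measure is Wiener measure
weighted by the Newtonian potential `|W_t|⁻²` of its current position.
[cite: LawlerSchrammWerner2003Restriction, §7.1 (second bullet, p. 28)] -/
theorem lintegral_loopBase_eq {t : ℝ≥0} (ht : 0 < t) {F : (Set.Iic t → Fin 4 → ℝ) → ℝ≥0∞}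
    (hF : Measurable F) :
    ∫⁻ p, (Ioi (t : ℝ)).indicator (fun _ ↦ (1 : ℝ≥0∞)) p.1 * F (quadLoopPast t p) ∂loopBase =
      ∫⁻ ω, F (vecPast brownianQuad t ω) * newtonFour (brownianQuad t ω) ∂wienerQuad := by
  have ht' : (0 : ℝ) < t := by exact_mod_cast ht
  have hG := measurable_bridgeAvg t hF
  set R : ℝ → (Fin 4 → ℝ) → ℝ≥0∞ := fun T z ↦
    ENNReal.ofReal ((T / (T - t)) ^ 2 * Real.exp (-(sqSum z / 2) / (T - t))) with hR
  have hRm : Measurable (Function.uncurry R) := measurable_ratioDensity t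
  -- Step B: the inner integral for a fixed duration `T > t`
  have hB : ∀ T : ℝ, (t : ℝ) < T →
      ∫⁻ ω, F (quadLoopPast t (T, ω)) ∂wienerQuad = ∫⁻ z, bridgeAvg t F z * R T z ∂gaussVec 4 t := by
    intro T hT
    have hw : (bridgeVar t T : ℝ) = t * (T - t) / T := coe_bridgeVar ht hT
    have hw0 : bridgeVar t T ≠ 0 := by
      intro h
      have hT0 : 0 < T := ht'.trans hT
      have : (bridgeVar t T : ℝ) = 0 := by rw [h]; rfl
      rw [hw] at this
      have : (0 : ℝ) < t * (T - t) / T := by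
        have := sub_pos.2 hT; positivity
      linarith
    rw [lintegral_quadLoopPast_eq ht hT hF, gaussVec_eq_withDensity_gaussRatio 4 ht.ne' hw0,
      lintegral_withDensity_eq_lintegral_mul₀ ?_ hG.aemeasurable]
    · refine lintegral_congr fun z ↦ ?_
      rw [Pi.mul_apply, prod_gaussRatio_eq ht hT hw z, mul_comm, hR]
      simp only
      have hTt : (T - t : ℝ) ≠ 0 := (sub_pos.2 hT).ne'
      congr 4
      field_simp
    · refine (Finset.measurable_fun_prod Finset.univ fun i _ ↦ ?_).aemeasurable
      exact ((measurable_gaussRatio _ _).comp (measurable_pi_apply i)).coe_nnreal_ennreal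
  -- Step C: the lifetime integral, `∫⁻_{T>t} (1/(2T²)) R_T(z) dT = 1/|z|²` for `z ≠ 0`
  have hC : ∀ z : Fin 4 → ℝ, z ≠ 0 →
      ∫⁻ T in Ioi (t : ℝ), loopDensity T * R T z = newtonFour z := by
    intro z hz
    have hb : 0 < sqSum z / 2 := by have := sqSum_pos_of_ne_zero hz; positivity
    have h := lintegral_Ioi_weight_ratio hb ht'
    simp only [loopDensity, hR, newtonFour]
    rw [h]
    congr 1
    field_simp
  -- both sides equal `∫ G(z) |z|⁻² N(0,tI)(dz)`
  have hmid : ∫⁻ T in Ioi (t : ℝ), loopDensity T * ∫⁻ z, bridgeAvg t F z * R T z ∂gaussVec 4 t =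
      ∫⁻ z, bridgeAvg t F z * newtonFour z ∂gaussVec 4 t := by
    have hm6 : Measurable fun q : ℝ × (Fin 4 → ℝ) ↦ bridgeAvg t F q.2 * (loopDensity q.1 * R q.1 q.2) :=
      (hG.comp measurable_snd).mul ((measurable_loopDensity.comp measurable_fst).mul hRm)
    calc ∫⁻ T in Ioi (t : ℝ), loopDensity T * ∫⁻ z, bridgeAvg t F z * R T z ∂gaussVec 4 t
        = ∫⁻ T in Ioi (t : ℝ), ∫⁻ z, bridgeAvg t F z * (loopDensity T * R T z) ∂gaussVec 4 t := by
          refine lintegral_congr fun T ↦ ?_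
          have hm11 : Measurable fun z ↦ bridgeAvg t F z * R T z :=
            hG.mul (hRm.comp (measurable_const.prodMk measurable_id))
          rw [← lintegral_const_mul (loopDensity T) hm11]
          refine lintegral_congr fun z ↦ ?_
          ring
      _ = ∫⁻ z, (∫⁻ T in Ioi (t : ℝ), bridgeAvg t F z * (loopDensity T * R T z)) ∂gaussVec 4 t :=
          lintegral_lintegral_swap hm6.aemeasurable
      _ = ∫⁻ z, bridgeAvg t F z * (∫⁻ T in Ioi (t : ℝ), loopDensity T * R T z) ∂gaussVec 4 t := by
          refine lintegral_congr fun z ↦ ?_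
          have hm12 : Measurable fun T ↦ loopDensity T * R T z :=
            measurable_loopDensity.mul (hRm.comp (measurable_id.prodMk measurable_const))
          rw [lintegral_const_mul (bridgeAvg t F z) hm12]
      _ = ∫⁻ z, bridgeAvg t F z * newtonFour z ∂gaussVec 4 t := by
          refine lintegral_congr_ae ?_
          filter_upwards [gaussVec_ae_ne_zero 4 ht.ne' (by norm_num)] with z hz
          rw [hC z hz]
  -- Step A: the left-hand side as an iterated integral
  have hLHS : ∫⁻ p, (Ioi (t : ℝ)).indicator (fun _ ↦ (1 : ℝ≥0∞)) p.1 * F (quadLoopPast t p) ∂loopBase =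
      ∫⁻ T in Ioi (t : ℝ), loopDensity T * ∫⁻ ω, F (quadLoopPast t (T, ω)) ∂wienerQuad := by
    have hm7 : Measurable fun p : ℝ × WienerQuad ↦
        (Ioi (t : ℝ)).indicator (fun _ ↦ (1 : ℝ≥0∞)) p.1 * F (quadLoopPast t p) :=
      ((measurable_const.indicator measurableSet_Ioi).comp measurable_fst).mul
        (hF.comp (measurable_quadLoopPast t))
    have hm8 : Measurable fun T : ℝ ↦ ∫⁻ ω, F (quadLoopPast t (T, ω)) ∂wienerQuad :=
      (hF.comp (measurable_quadLoopPast t)).lintegral_prod_right'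
    unfold loopBase
    rw [lintegral_prod _ hm7.aemeasurable]
    have h1 : ∀ T, ∫⁻ ω, (Ioi (t : ℝ)).indicator (fun _ ↦ (1 : ℝ≥0∞)) T * F (quadLoopPast t (T, ω)) ∂wienerQuad
        = (Ioi (t : ℝ)).indicator (fun T ↦ ∫⁻ ω, F (quadLoopPast t (T, ω)) ∂wienerQuad) T := by
      intro T
      by_cases hT : T ∈ Ioi (t : ℝ)
      · rw [indicator_of_mem hT, indicator_of_mem hT]
        simp only [one_mul]
      · rw [indicator_of_notMem hT, indicator_of_notMem hT]
        simp only [zero_mul, lintegral_const, zero_mul]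
    simp only [h1]
    unfold loopTimeMeasure
    rw [lintegral_withDensity_eq_lintegral_mul₀ measurable_loopDensity.aemeasurable
      (hm8.indicator measurableSet_Ioi).aemeasurable]
    have h2 : ∀ T, (loopDensity * (Ioi (t : ℝ)).indicator
        (fun T ↦ ∫⁻ ω, F (quadLoopPast t (T, ω)) ∂wienerQuad)) T =
        (Ioi (t : ℝ)).indicator (fun T ↦ loopDensity T * ∫⁻ ω, F (quadLoopPast t (T, ω)) ∂wienerQuad) T := by
      intro T
      by_cases hT : T ∈ Ioi (t : ℝ)
      · rw [indicator_of_mem hT, Pi.mul_apply, indicator_of_mem hT]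
      · rw [indicator_of_notMem hT, Pi.mul_apply, indicator_of_notMem hT, mul_zero]
    simp only [h2]
    rw [lintegral_indicator measurableSet_Ioi, Measure.restrict_restrict measurableSet_Ioi,
      Ioi_inter_Ioi, sup_eq_left.2 ht'.le]
  -- Step D: the right-hand side
  have hRHS : ∫⁻ ω, F (vecPast brownianQuad t ω) * newtonFour (brownianQuad t ω) ∂wienerQuad =
      ∫⁻ z, bridgeAvg t F z * newtonFour z ∂gaussVec 4 t := by
    have hl := measurable_linPast t
    have hb := measurable_quadBridgePast t
    have hm9 : Measurable fun q : (Set.Iic t → Fin 4 → ℝ) × (Fin 4 → ℝ) ↦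
        F (q.1 + linPast t q.2) * newtonFour q.2 := by fun_prop
    calc ∫⁻ ω, F (vecPast brownianQuad t ω) * newtonFour (brownianQuad t ω) ∂wienerQuad
        = ∫⁻ ω, (fun q : (Set.Iic t → Fin 4 → ℝ) × (Fin 4 → ℝ) ↦ F (q.1 + linPast t q.2) * newtonFour q.2)
            (quadBridgePast t ω, brownianQuad t ω) ∂wienerQuad := by
          simp only [vecPast_eq_quadBridgePast_add]
          rfl
      _ = ∫⁻ ω, ∫⁻ w, F (quadBridgePast t ω + linPast t w) * newtonFour w ∂gaussVec 4 t ∂wienerQuad := by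
          rw [lintegral_comp_eq_lintegral_lintegral_of_indepFun hb (measurable_brownianQuad t)
            (indepFun_quadBridgePast t) hm9, map_brownianQuad]
      _ = ∫⁻ w, ∫⁻ ω, F (quadBridgePast t ω + linPast t w) * newtonFour w ∂wienerQuad ∂gaussVec 4 t := by
          have hm10 : Measurable fun r : WienerQuad × (Fin 4 → ℝ) ↦
              F (quadBridgePast t r.1 + linPast t r.2) * newtonFour r.2 := by fun_prop
          exact lintegral_lintegral_swap hm10.aemeasurable
      _ = ∫⁻ z, bridgeAvg t F z * newtonFour z ∂gaussVec 4 t := by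
          refine lintegral_congr fun w ↦ ?_
          rw [lintegral_mul_const _ (by fun_prop)]
          rfl
  -- assemble
  rw [hLHS, hRHS, ← hmid]
  refine setLIntegral_congr_fun measurableSet_Ioi fun T hT ↦ ?_
  rw [hB T hT]

end Literature.Probability.Process

end
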